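import Literature.Topology.FourManifolds.BordismFourFiniteness
import Literature.AlgebraicTopology.SingularHomology.LefschetzDualityProofs
import HarnessLib

/-!
# `isOrientedBordant_iff_signature_eq` from Poincaré duality and Thom IV.13 alone
(Layer 8 of `Literature.Topology.FourManifolds.isOrientedBordant_iff_signature_eq`)

Sibling proof file of `Literature.Topology.FourManifolds.BordismFourFiniteness`.  There spc4.S36
(two closed oriented smooth 4-manifolds are oriented bordant iff their signatures agree; Thom 1954,
Thm IV.1 + Thm IV.13) was proved from three named facts: Lefschetz duality for compact
5-manifolds with boundary (`hL`, Spanier Thm. 6.3.12), Poincaré duality for closed 4-manifolds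
(`hD`, Hatcher Thm. 3.30) and, for the converse direction, Thom's Thm IV.13 (`h₂`).  Lefschetz
duality is now a THEOREM of `Literature`:
`Literature.AlgebraicTopology.SingularHomology.bijective_relCapProduct_of_isRelFundamentalClass_holds`
(`…LefschetzDualityProofs`: the external collar `X = W ∪ ∂W × (-∞, 0]`, oriented by the
relative fundamental class, Poincaré–Alexander duality along the compact `W ⊆ X` — H. Miller,
*Lectures on Algebraic Topology* (2020), Thm. 37.1 — and the transport to every universe).

* `two_mul_boundaryImageRank_eq_of_poincareDuality` — Thom 1952 Cor. V.8 (`n = 4`, `p = 2`) from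
  `hD` alone;
* `signature_eq_of_isOrientedBordant_of_poincareDuality` — **Thom's Thm IV.1 in dimension four
  from Poincaré duality of closed 4-manifolds alone**;
* `isOrientedBordant_iff_signature_eq_of_poincareDuality` — spc4.S36 from `hD`, `h₂`.
  REMAINING HYPOTHESES: 2 (`hD` = `bijective_poincareDualityMap`, Hatcher Thm. 3.30, the `K = X`
  case of Miller's theorem; `h₂` = `isOrientedBordant_of_signature_eq`, Thom Thm IV.13).

## References

* R. Thom, *Quelques propriétés globales des variétés différentiables*, Comment. Math. Helv. 28
  (1954), Thm IV.1 (p. 65), Thm IV.13 (p. 81). [ThomCMH1954]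
* R. Thom, *Espaces fibrés en sphères et carrés de Steenrod*, Ann. Sci. ENS 69 (1952), Cor. V.8
  (p. 173). [Thom1952]
* E. H. Spanier, *Algebraic Topology*, Springer 1981, Ch. 6 §3 Thm. 12. [Spanier1981]
* A. Hatcher, *Algebraic Topology*, CUP 2002, Thm. 3.30, Thm. 3.43. [Hatcher2002]
* H. Miller, *Lectures on Algebraic Topology*, World Scientific 2020, Thm. 37.1. [Miller2020]
-/

noncomputable section

open scoped Manifold ContDiff Topology

universe u

namespace Literature.Topology.FourManifolds

section SPC4

/-- **Thom 1952, Cor. V.8 for `n = 4`, `p = 2` from Poincaré duality of closed 4-manifolds alone**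
("half lives, half dies"): Lefschetz duality is the theorem
`bijective_relCapProduct_of_isRelFundamentalClass_holds`.  PROVED. [cite: Thom1952, Cor. V.8 (p. 173)] -/
theorem two_mul_boundaryImageRank_eq_of_poincareDuality
    (hD : ∀ {P : Type u} [TopologicalSpace P] [T2Space P] [CompactSpace P]
      [ChartedSpace (EuclideanSpace ℝ (Fin 4)) P] (π : Literature.AlgebraicTopology.SingularHomology.HomologicalOrientation ℤ P 4),
      Literature.AlgebraicTopology.SingularHomology.bijective_poincareDualityMap π two_add_two_eq_four) :
    two_mul_boundaryImageRank_eq.{u} :=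
  two_mul_boundaryImageRank_eq_of_duality'
    (fun {W} _ _ _ _ z hz =>
      Literature.AlgebraicTopology.SingularHomology.bijective_relCapProduct_of_isRelFundamentalClass_holds
        4 W z hz _)
    hD

/-- **Thom's Thm IV.1 in dimension four (bordism invariance of the signature) from Poincaré duality
of closed 4-manifolds alone**: if two closed oriented smooth 4-manifolds are oriented bordant,
their signatures agree.  Lefschetz duality for the bordism (Spanier Thm. 6.3.12), universal
coefficients, graded commutativity of `⌣`, fundamental classes, all finiteness statements, the
duality ladder, the isotropy of `A²` and Sylvester's law are theorems of `Literature`.  PROVED.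
[cite: ThomCMH1954, Thm IV.1 (p. 65)] -/
theorem signature_eq_of_isOrientedBordant_of_poincareDuality
    (hD : ∀ {P : Type u} [TopologicalSpace P] [T2Space P] [CompactSpace P]
      [ChartedSpace (EuclideanSpace ℝ (Fin 4)) P] (π : Literature.AlgebraicTopology.SingularHomology.HomologicalOrientation ℤ P 4),
      Literature.AlgebraicTopology.SingularHomology.bijective_poincareDualityMap π two_add_two_eq_four) :
    signature_eq_of_isOrientedBordant.{u} :=
  signature_eq_of_isOrientedBordant_of_duality''
    (fun {W} _ _ _ _ z hz =>
      Literature.AlgebraicTopology.SingularHomology.bijective_relCapProduct_of_isRelFundamentalClass_holds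
        4 W z hz _)
    hD

/-- **spc4.S36 (`isOrientedBordant_iff_signature_eq`) from Poincaré duality and Thom's Thm IV.13**
— two inputs: `hD` (Hatcher Thm. 3.30, closed 4-manifolds) and `h₂` (`Ω⁴ ≅ ℤ` detected by the
signature — the converse direction).  PROVED.
[cite: ThomCMH1954, Thm IV.1 (p. 65) and Thm IV.13 (p. 81)] -/
theorem isOrientedBordant_iff_signature_eq_of_poincareDuality
    (hD : ∀ {P : Type u} [TopologicalSpace P] [T2Space P] [CompactSpace P]
      [ChartedSpace (EuclideanSpace ℝ (Fin 4)) P] (π : Literature.AlgebraicTopology.SingularHomology.HomologicalOrientation ℤ P 4),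
      Literature.AlgebraicTopology.SingularHomology.bijective_poincareDualityMap π two_add_two_eq_four)
    (h₂ : isOrientedBordant_of_signature_eq.{u}) : isOrientedBordant_iff_signature_eq.{u} :=
  isOrientedBordant_iff_signature_eq_of (signature_eq_of_isOrientedBordant_of_poincareDuality hD) h₂

end SPC4

end Literature.Topology.FourManifolds

end
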